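import Summits.NavierStokesRegularity.NavierStokesRegularity.Theorems.PerpetualPumpCircuitPumpActiveCore
import Summits.NavierStokesRegularity.NavierStokesRegularity.Theorems.PerpetualPumpCircuitPumpClockBoxWindow
import Summits.NavierStokesRegularity.NavierStokesRegularity.Theorems.PerpetualPumpCircuitPumpTruncStructure

/-!
# `PerpetualPump.CircuitPump` (stmt-NavierStokesRegularity-1834), line `singular-clock-gspt`:
# COVER and PHASE for the Toda clock box

Sub-goal `toda_cover` of `stub_clockBox` (Toda `m = 2` instance). For box data at amplitude
`A ∈ [A₁, A₂]` and a solution of the `L`-truncated seeded graded Toda system on `[0, Tmax]` staying in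
the corridor (`b 1 ≤ 1/4`, `b (-1) ≤ 1`, `|a 2| ≤ 1`), the active block
`(u, v, w, z, e, y) = (a 0, b 0, a 1, b 1, b (-1), a 2)` satisfies the hypotheses of
`toda_active_core` (bond signs from `toda_trunc_structure`, sizes from `toda_clockBox_window`); its
outputs — the gate radius `W = R(t₃)` with `|W − (A − ℓ₁)| ≤ 903 + 50 log A` (from `tg ∈ [τ⁻, τ⁺]`,
`A e^{−τ∓} = A − (ℓ₁ ∓ …)`), the tracking `w = W e^{−ν(t−t₃)} ± 30` and the bracket of `z(t₃)` — feed
`toda_active_clock` on `[t₃, Tmax]`. Its affine clock `|q w − (qA − (q+1)Λ/2)| ≤ 1500 + 85 log A`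
at phase match, the fixed-point identity `(q−1)A⋆ = (q+1)Λ/2` and the covering margin
`1500 + 85 log A < (q−1)A⋆/10` give the strict exit through the amplitude faces `A = A₁, A₂`
(COVER); its items (b), (c) at `T₁ = t₃ + Δ⁻`, `T₂ = t₃ + Δ⁺` give the phase crossing (PHASE).
[folklore]
-/

set_option linter.dupNamespace false

noncomputable section

open Set

namespace Summit.NavierStokesRegularity.NavierStokesRegularity.Theorems.PerpetualPumpCircuitPump

/-- The active block of the truncated Toda system: the equations at scales `n = 0, 1` are the
hypotheses of `toda_active_core` for `(u, v, w, z, e, y) = (a 0, b 0, a 1, b 1, b (-1), a 2)`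
(`lam^{(4/5)·0} = lam^0 = 1`, `lam^{0-1} = lam⁻¹`, `lam^{(4/5)·1} = ν`, `lam^1 = lam`). [folklore] -/
theorem cover_odes {lam ν ε S : ℝ} {L : ℕ} {a b : ℤ → ℝ → ℝ} (hν : ν = lam ^ (4 / 5 : ℝ))
    (hL : 2 ≤ L)
    (hode : ∀ n : ℤ, |n| ≤ (L : ℤ) → ∀ t ∈ Set.Ico 0 S, HasDerivWithinAt (a n)
      (-(lam ^ ((4 / 5 : ℝ) * n)) * a n t - lam ^ (n : ℝ) * b n t ^ 2 + lam ^ ((n : ℝ) - 1) *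
        b (n - 1) t ^ 2 - ε * lam ^ (n : ℝ) * a n t * b n t) (Set.Ici t) t ∧
      HasDerivWithinAt (b n) (-(lam ^ ((4 / 5 : ℝ) * n)) * b n t + lam ^ (n : ℝ) * b n t *
        (a n t - a (n + 1) t) + ε * lam ^ (n : ℝ) * a n t ^ 2) (Set.Ici t) t) :
    (∀ t ∈ Set.Ico 0 S, HasDerivWithinAt (a 0)
      (-a 0 t - b 0 t ^ 2 + lam⁻¹ * b (-1) t ^ 2 - ε * a 0 t * b 0 t) (Set.Ici t) t) ∧
    (∀ t ∈ Set.Ico 0 S, HasDerivWithinAt (b 0)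
      (b 0 t * (a 0 t - a 1 t) - b 0 t + ε * a 0 t ^ 2) (Set.Ici t) t) ∧
    (∀ t ∈ Set.Ico 0 S, HasDerivWithinAt (a 1)
      (-ν * a 1 t + b 0 t ^ 2 - lam * b 1 t ^ 2 - ε * lam * a 1 t * b 1 t) (Set.Ici t) t) ∧
    (∀ t ∈ Set.Ico 0 S, HasDerivWithinAt (b 1)
      (b 1 t * (lam * (a 1 t - a 2 t) - ν) + ε * lam * a 1 t ^ 2) (Set.Ici t) t) := by
  have h0 : |(0 : ℤ)| ≤ (L : ℤ) := by simp
  have h1 : |(1 : ℤ)| ≤ (L : ℤ) := by rw [abs_one]; exact_mod_cast (by omega : 1 ≤ L)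
  refine ⟨fun t ht => ?_, fun t ht => ?_, fun t ht => ?_, fun t ht => ?_⟩
  · have h := (hode 0 h0 t ht).1
    refine h.congr_deriv ?_
    simp only [Int.cast_zero, mul_zero, Real.rpow_zero, zero_sub, Real.rpow_neg_one]
    ring
  · have h := (hode 0 h0 t ht).2
    refine h.congr_deriv ?_
    simp only [Int.cast_zero, mul_zero, Real.rpow_zero, zero_add]
    ring
  · have h := (hode 1 h1 t ht).1
    refine h.congr_deriv ?_
    simp only [Int.cast_one, mul_one, Real.rpow_one, sub_self, Real.rpow_zero, ← hν]
    ring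
  · have h := (hode 1 h1 t ht).2
    refine h.congr_deriv ?_
    simp only [Int.cast_one, mul_one, Real.rpow_one, one_add_one_eq_two, ← hν]
    ring

/-- Sizes of the pieces of `t₃ = τ⁺ + (250 + 16 log A)/A`: `τ⁺ = -log (1 - x) ≥ 0` with
`x = (ℓ₁ + 11/5)/A < 1`, and `(250 + 16 log A)/A ≥ 0`. [folklore] -/
theorem cover_x {Λ A : ℝ} (hA : 40000 ≤ A) (hΛ0 : 0 < Λ) (hΛA : Λ ≤ A / 5) :
    0 ≤ -Real.log (1 - ((Λ / 2 + Real.log (A / 8)) + 11 / 5) / A) ∧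
    ((Λ / 2 + Real.log (A / 8)) + 11 / 5) / A < 1 ∧ 0 ≤ (250 + 16 * Real.log A) / A := by
  obtain ⟨hlogA, hlin⟩ := activeClock_logA hA
  have hA0 : 0 < A := by linarith only [hA]
  have h8 : 0 ≤ Real.log (A / 8) := Real.log_nonneg (by linarith only [hA])
  have h8' : Real.log (A / 8) ≤ Real.log A :=
    Real.log_le_log (by positivity) (by linarith only [hA])
  have hx0 : 0 ≤ ((Λ / 2 + Real.log (A / 8)) + 11 / 5) / A :=
    div_nonneg (by linarith only [hΛ0, h8]) hA0.le
  have hx1 : ((Λ / 2 + Real.log (A / 8)) + 11 / 5) / A < 1 := by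
    rw [div_lt_one hA0]; linarith only [hΛA, h8', hlin, hlogA, hA]
  refine ⟨?_, hx1, by positivity⟩
  have h1x : 0 ≤ 1 - ((Λ / 2 + Real.log (A / 8)) + 11 / 5) / A := by linarith only [hx1]
  have := Real.log_nonpos h1x (by linarith only [hx0])
  linarith only [this]

/-- From the gate-time bracket `tg ∈ [τ⁻, τ⁺]` (`A e^{-τ∓} = A - (ℓ₁ ∓ (6/5 | -11/5))`) and the
radius estimate `|W - A e^{-tg}| ≤ 900 + 50 log A`: `|W - (A - ℓ₁)| ≤ 903 + 50 log A`. [folklore] -/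
theorem cover_W {A ℓ tg W : ℝ} (hA : 0 < A) (hx : (ℓ + 11 / 5) / A < 1)
    (h1 : -Real.log (1 - (ℓ - 6 / 5) / A) ≤ tg) (h2 : tg ≤ -Real.log (1 - (ℓ + 11 / 5) / A))
    (hW : |W - A * Real.exp (-tg)| ≤ 900 + 50 * Real.log A) :
    |W - (A - ℓ)| ≤ 903 + 50 * Real.log A := by
  have hxm : (ℓ - 6 / 5) / A < 1 :=
    lt_of_le_of_lt (div_le_div_of_nonneg_right (by linarith only) hA.le) hx
  have e1 : Real.exp (-(-Real.log (1 - (ℓ - 6 / 5) / A))) = 1 - (ℓ - 6 / 5) / A := by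
    rw [neg_neg, Real.exp_log (by linarith only [hxm])]
  have e2 : Real.exp (-(-Real.log (1 - (ℓ + 11 / 5) / A))) = 1 - (ℓ + 11 / 5) / A := by
    rw [neg_neg, Real.exp_log (by linarith only [hx])]
  have i1 : Real.exp (-tg) ≤ 1 - (ℓ - 6 / 5) / A := by
    rw [← e1]; exact Real.exp_le_exp.mpr (by linarith only [h1])
  have i2 : 1 - (ℓ + 11 / 5) / A ≤ Real.exp (-tg) := by
    rw [← e2]; exact Real.exp_le_exp.mpr (by linarith only [h2])
  have j1 : A * Real.exp (-tg) ≤ A - ℓ + 6 / 5 := by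
    have h := mul_le_mul_of_nonneg_left i1 hA.le
    have e : A * (1 - (ℓ - 6 / 5) / A) = A - ℓ + 6 / 5 := by field_simp; ring
    linarith only [h, e]
  have j2 : A - ℓ - 11 / 5 ≤ A * Real.exp (-tg) := by
    have h := mul_le_mul_of_nonneg_left i2 hA.le
    have e : A * (1 - (ℓ + 11 / 5) / A) = A - ℓ - 11 / 5 := by field_simp; ring
    linarith only [h, e]
  have hW' := abs_le.mp hW
  rw [abs_le]; constructor <;> linarith only [hW', j1, j2]

/-- `t₃ < Tmax` from `0 < Δ⁻`, `T₁ ≤ T₂ ≤ Tmax`. [folklore] -/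
theorem cover_t3lt {t₃ Δm Δp Tmax : ℝ} (h0 : 0 < Δm) (h1 : t₃ + Δm ≤ t₃ + Δp)
    (h2 : t₃ + Δp ≤ Tmax) : t₃ < Tmax := by linarith only [h0, h1, h2]

/-- COVER and PHASE from the three conclusions of `toda_active_clock` on `[t₃, Tmax]`, the clock
fixed point `(q-1) A⋆ = (q+1) Λ/2`, the faces `A₁ = 0.9 A⋆`, `A₂ = 1.1 A⋆` and the covering margin
`E < (q-1) A⋆/10`. [folklore] -/
theorem cover_finish {q sε A A₁ A₂ As Λ E t₃ Δm Δp Tmax : ℝ} {a1 b1 : ℝ → ℝ} (hq1 : 1 < q)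
    (hrel : (q - 1) * As = (q + 1) * Λ / 2) (hA₁ : A₁ = 9 / 10 * As) (hA₂ : A₂ = 11 / 10 * As)
    (hmargin : E < 1 / 10 * (q - 1) * As) (hΔm : 0 < Δm) (h12 : t₃ + Δm ≤ t₃ + Δp)
    (h2 : t₃ + Δp ≤ Tmax)
    (hca : ∀ t ∈ Set.Icc t₃ Tmax, b1 t = sε / q → |q * a1 t - (q * A - (q + 1) * Λ / 2)| ≤ E)
    (hcb : ∀ t ∈ Set.Icc t₃ Tmax, t - t₃ ≤ Δm → b1 t < sε / q)
    (hcc : ∀ t ∈ Set.Icc t₃ Tmax, Δp ≤ t - t₃ → sε / q < b1 t) :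
    (∀ T ∈ Set.Icc (t₃ + Δm) (t₃ + Δp), q * b1 T = sε →
      (A = A₁ → q * a1 T < A₁) ∧ (A = A₂ → A₂ < q * a1 T)) ∧
    q * b1 (t₃ + Δm) < sε ∧ sε < q * b1 (t₃ + Δp) := by
  have hq0 : 0 < q := by linarith only [hq1]
  refine ⟨fun T hT hph => ?_, ?_, ?_⟩
  · have hTm : T ∈ Set.Icc t₃ Tmax :=
      ⟨by linarith only [hT.1, hΔm], by linarith only [hT.2, h2]⟩
    have hz : b1 T = sε / q := by
      rw [eq_div_iff hq0.ne']; linarith only [hph]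
    have h := abs_le.mp (hca T hTm hz)
    constructor
    · intro hA; rw [hA, hA₁] at h; rw [hA₁]; nlinarith only [h, hrel, hmargin]
    · intro hA; rw [hA, hA₂] at h; rw [hA₂]; nlinarith only [h, hrel, hmargin]
  · have hmem : t₃ + Δm ∈ Set.Icc t₃ Tmax :=
      ⟨by linarith only [hΔm], by linarith only [h12, h2]⟩
    have h := hcb _ hmem (by linarith only)
    exact (lt_div_iff₀' hq0).mp h
  · have hmem : t₃ + Δp ∈ Set.Icc t₃ Tmax :=
      ⟨by linarith only [hΔm, h12], h2⟩
    have h := hcc _ hmem (by linarith only)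
    exact (div_lt_iff₀' hq0).mp h

/-- **COVER / PHASE for the Toda clock box** (second half of the former `toda_into`): strict exit through
the amplitude faces at phase match (`toda_active_clock` (a) + the covering margin of `toda_clockBox_window`)
and the phase crossing inside the window (`toda_active_clock` (b),(c)), on top of `toda_active_core` applied
on `[0,Tmax]` with the corridor given. -/
theorem toda_cover :
    ∀ (lam ν q r ε Λ As A₁ A₂ Tmax : ℝ),
    1 < lam → lam ≤ 3 / 2 → ν = lam ^ (4 / 5 : ℝ) → q = lam ^ (1 / 5 : ℝ) → r = lam ^ (-(4 / 5 : ℝ)) →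
    0 < ε → Λ = -Real.log ε → As = (q + 1) * Λ / (2 * (q - 1)) → A₁ = 9 / 10 * As → A₂ = 11 / 10 * As →
    40000 ≤ A₁ → 100000 * (Real.log A₂ + 500) ≤ Λ →
    Tmax = (-Real.log (1 - (((Λ) / 2 + Real.log (A₂ / 8)) + 11 / 5) / A₁) + (250 + 16 * Real.log A₂) / A₁ + (-(1 / ν) * Real.log (1 - ν * ((Λ) / 2 - Real.log q + 73) / (lam * (A₁ - ((Λ) / 2 + Real.log (A₁ / 8)) - 903 - 50 * Real.log A₁))))) →
    ε ≤ 1 / 100000 →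
    ∀ (L : ℕ) (A : ℝ) (a b : ℤ → ℝ → ℝ), 2 ≤ L →
    a 0 0 = A → A₁ ≤ A → A ≤ A₂ → b 0 0 = Real.sqrt ε → -ε ^ 2 ≤ a 1 0 → a 1 0 ≤ ε ^ (3 / 4 : ℝ) →
    0 ≤ b 1 0 → b 1 0 ≤ ε ^ (3 / 2 : ℝ) → (∀ n : ℤ, 0 ≤ b n 0) →
    (∀ n : ℤ, 2 ≤ n → |a n 0| ≤ ε ^ 2 * (2 * lam) ^ (-(n : ℝ)) ∧ b n 0 ≤ ε ^ (3 / 2 : ℝ) * (2 * lam) ^ (-(n : ℝ))) →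
    (∀ n : ℤ, n ≤ -1 → |a n 0| ≤ 13 * lam ^ (-(n : ℝ) / 5) * (2 - lam ^ ((4 / 5 : ℝ) * n)) ∧
      b n 0 ≤ 40 / A₁ * lam ^ (-(n : ℝ) / 5) * Real.exp ((65 + 169 / 10 * ε * A₁) * Tmax * (1 - lam ^ ((4 / 5 : ℝ) * (n + 1))) / (1 - r))) →
    (∀ n : ℤ, (L : ℤ) < |n| → ∀ t ∈ Set.Icc 0 Tmax, a n t = 0 ∧ b n t = 0) → (∀ n : ℤ, |n| ≤ (L : ℤ) → ContinuousOn (a n) (Set.Icc 0 Tmax) ∧ ContinuousOn (b n) (Set.Icc 0 Tmax)) → (∀ n : ℤ, |n| ≤ (L : ℤ) → ∀ t ∈ Set.Ico 0 Tmax, HasDerivWithinAt (a n) (-(lam ^ ((4 / 5 : ℝ) * n)) * a n t - lam ^ (n : ℝ) * b n t ^ 2 + lam ^ ((n : ℝ) - 1) * b (n - 1) t ^ 2 - ε * lam ^ (n : ℝ) * a n t * b n t) (Set.Ici t) t ∧ HasDerivWithinAt (b n) (-(lam ^ ((4 / 5 : ℝ) * n)) * b n t + lam ^ (n : ℝ)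 * b n t * (a n t - a (n + 1) t) + ε * lam ^ (n : ℝ) * a n t ^ 2) (Set.Ici t) t) →
    (∀ t ∈ Set.Icc 0 Tmax, b 1 t ≤ 1 / 4 ∧ b (-1) t ≤ 1 ∧ |a 2 t| ≤ 1) →
    (∀ t ∈ Set.Icc 0 Tmax, t ≤ ((-Real.log (1 - (((Λ) / 2 + Real.log (A / 8)) + 11 / 5) / A)) + (250 + 16 * Real.log A) / A) → b 1 t ≤ ε * A ^ 27 * Real.exp 400) →
    (∀ T ∈ Set.Icc (((-Real.log (1 - (((Λ) / 2 + Real.log (A / 8)) + 11 / 5) / A)) + (250 + 16 * Real.log A) / A) + (-(1 / ν) * Real.log (1 - ν * ((Λ) / 2 - Real.log q - 28 * Real.log A - 449) / (lam * (A - ((Λ) / 2 + Real.log (A / 8)) + 903 + 50 * Real.log A))))) (((-Real.log (1 - (((Λ) / 2 + Real.log (A / 8)) + 11 / 5) / A)) + (250 + 16 * Real.log A) / A) + (-(1 / ν) * Real.log (1 - ν * ((Λ) / 2 - Real.log q + 73) / (lam * (A - ((Λ) / 2 + Real.log (A / 8)) - 903 - 50 * Real.log A))))),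
      q * b 1 T = Real.sqrt ε → (A = A₁ → q * a 1 T < A₁) ∧ (A = A₂ → A₂ < q * a 1 T)) ∧
    q * b 1 (((-Real.log (1 - (((Λ) / 2 + Real.log (A / 8)) + 11 / 5) / A)) + (250 + 16 * Real.log A) / A) + (-(1 / ν) * Real.log (1 - ν * ((Λ) / 2 - Real.log q - 28 * Real.log A - 449) / (lam * (A - ((Λ) / 2 + Real.log (A / 8)) + 903 + 50 * Real.log A))))) < Real.sqrt ε ∧ Real.sqrt ε < q * b 1 (((-Real.log (1 - (((Λ) / 2 + Real.log (A / 8)) + 11 / 5) / A)) + (250 + 16 * Real.log A) / A) + (-(1 / ν) * Real.log (1 - ν * ((Λ) / 2 - Real.log q + 73) / (lam * (A - ((Λ) / 2 + Real.log (A / 8)) - 903 - 50 * Real.log A))))) := by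
  intro lam ν q r ε Λ As A₁ A₂ Tmax hlam hlam2 hν hq _hr hε hΛ hAs hA₁ hA₂ h40000 HBIG hTmax _hε1
    L A a b hL ha0 hAlo hAhi hb0 ha1lo ha1hi hb1lo hb1hi hbn0 _hprec _htrail htrunc hcont hode
    hcorr _hzsup
  subst hΛ
  -- constants and window numerics
  obtain ⟨-, -, hq1, -, -, -, -⟩ := activeClock_consts hlam hlam2 hν hq
  obtain ⟨-, -, -, hΛ0, -, hrel, -, -, -, -⟩ :=
    clockBox_consts hlam hlam2 hν hq hAs hA₁ hA₂ h40000 HBIG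
  obtain ⟨-, hTmin0, hTmax8, hwin, hpt⟩ :=
    toda_clockBox_window lam ν q ε _ As A₁ A₂ hlam hlam2 hν hq hε rfl hAs hA₁ hA₂ h40000 HBIG
  obtain ⟨hT1lo, hT12, hT2hi⟩ := hwin A ⟨hAlo, hAhi⟩
  obtain ⟨hA4, hΛA, hεA, hsεA, -, -, hΔm0, -, -, -, hmargin⟩ := hpt A ⟨hAlo, hAhi⟩
  clear hwin hpt
  have hT2T := hT2hi.trans_eq hTmax.symm
  have hTmax2 : Tmax ≤ 1 / 2 := by linarith only [hTmax.trans_le hTmax8]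
  have hTmax0 : 0 < Tmax := hTmin0.trans_le (hT1lo.trans (hT12.trans hT2T))
  have ht₃T := cover_t3lt hΔm0 hT12 hT2T
  have hA0 : 0 < A := by linarith only [hA4]
  have hlam0 : 0 < lam := by linarith only [hlam]
  obtain ⟨hτ0, hx1, hπ0⟩ := cover_x hA4 hΛ0 hΛA
  have ht₃0 := add_nonneg hτ0 hπ0
  -- structure of the truncated flow: bonds stay nonnegative
  obtain ⟨hbpos, -⟩ :=
    toda_trunc_structure lam ε Tmax L a b hlam0 hε.le hTmax0 htrunc hcont hode hbn0
  -- the active block on `[0, Tmax]`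
  obtain ⟨hdu, hdv, hdw, hdz⟩ := cover_odes hν hL hode
  have hL1 : |(1 : ℤ)| ≤ (L : ℤ) := by rw [abs_one]; exact_mod_cast (by omega : 1 ≤ L)
  have hL2 : |(2 : ℤ)| ≤ (L : ℤ) := by rw [abs_two]; exact_mod_cast hL
  have hLm1 : |(-1 : ℤ)| ≤ (L : ℤ) := by rw [abs_neg]; exact hL1
  obtain ⟨hcu, hcv⟩ := hcont 0 (by simp)
  obtain ⟨hcw, hcz⟩ := hcont 1 hL1
  have hce := (hcont (-1) hLm1).2
  have hcy := (hcont 2 hL2).1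
  obtain ⟨-, ⟨tg, htg1, htg2, -, -, -, hR⟩, htrack, hz3, hzlo, hzhi⟩ :=
    toda_active_core lam ν ε A Tmax (a 0) (b 0) (a 1) (b 1) (b (-1)) (a 2) hlam hlam2 hν hε hTmax0
      hTmax2 hA4 hΛA hεA hsεA ht₃T.le ha0 hb0 ha1lo ha1hi hb1lo hb1hi hcu hcv hcw hcz hce hcy hdu
      hdv hdw hdz (fun t ht => ⟨hbpos (-1) t ht, (hcorr t ht).2.1⟩) (fun t ht => (hcorr t ht).2.2)
      (fun t ht => (hcorr t ht).1.trans (by norm_num))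
  have hW := cover_W hA0 hx1 htg1 htg2 hR
  -- the clock on `[t₃, Tmax]`
  obtain ⟨hca, hcb, hcc⟩ :=
    toda_active_clock lam ν q ε A _ Tmax _ (a 1) (b 1) (a 2) hlam hlam2 hν hq hε hA4 hΛA hεA ht₃0
      ht₃T hTmax2 hW (hcw.mono (Set.Icc_subset_Icc_left ht₃0))
      (hcz.mono (Set.Icc_subset_Icc_left ht₃0)) (hcy.mono (Set.Icc_subset_Icc_left ht₃0))
      (fun t ht => hdz t ⟨ht₃0.trans ht.1, ht.2⟩) (fun t ht => (htrack t ht).1)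
      (fun t ht => (hcorr t ⟨ht₃0.trans ht.1, ht.2⟩).2.2) hz3 hzlo hzhi
  -- COVER and PHASE
  exact cover_finish hq1 hrel hA₁ hA₂ hmargin hΔm0 hT12 hT2T hca hcb hcc

end Summit.NavierStokesRegularity.NavierStokesRegularity.Theorems.PerpetualPumpCircuitPump
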